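import Summits.KontsevichZagierPeriods.KontsevichZagierPeriods.Theorems.HurwitzMicroSectorsNormalFormPrincipleLevelTwoEvenLayer
import Summits.KontsevichZagierPeriods.KontsevichZagierPeriods.Theorems.HurwitzMicroSectorsNormalFormPrincipleLevelKPowerSubstitution

/-!
# `NormalFormPrinciple` (stmt-KontsevichZagierPeriods-3869), line `SketchIdeator1` — leaf `stub_boxRigidity`:
# WEIGHT TWO, RESONANT BOXES WITH `2θ ∈ ℤ` JOIN THE π²-LAYER (rule 2), unconditionally

A weight-two monomial box `[(0,1)², c x^a y^b/(1 − x^{k₁} y^{k₂})]` is RESONANT when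
`θ := (a+1)/k₁ = (b+1)/k₂`; its value is then `(c/(k₁k₂))·ζ(2, θ)`-like. When `θ = j` is an integer
the power substitution `(X,Y) ↦ (X^{k₁}, Y^{k₂})` (rule 2, `LevelK.power_substitution`) turns it into
the algebraic level-one box `[(0,1)², (c/(k₁k₂)) (uv)^{j−1}/(1 − uv)]` (`resonantInt_sub_levelOne`);
when `θ = j + ½` (so `k₁ = 2k₁'`, `k₂ = 2k₂'`) the substitution `(X,Y) ↦ (X^{k₁'}, Y^{k₂'})` turns it
into the even level-two diagonal box `[(0,1)², (c/(k₁'k₂')) (uv)^{2j}/(1 − u²v²)]`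
(`resonantHalf_sub_levelTwo`). Hence the kernel theorem of the even level-two layer
(`AlgLevelTwo.levelTwoEven_mem_relations_of_eval_eq_zero_of_mem_closure`, Lindemann) extends to the
subgroup generated together with ALL resonant boxes with `2θ ∈ ℤ`, of all levels, with algebraic
coefficients (`resonant_mem_relations_of_eval_eq_zero_of_mem_closure`) — e.g.
`∫∫ y dxdy/(1 − x²y⁴) = π²/16` against a ζ-box. Together with the off-resonance layer
(`…LevelKLayer`, Baker) this classifies the weight-two monomial boxes: off resonance → Baker;
resonant with `2θ ∈ ℤ` → `π²`; the remaining resonant boxes are the route's sectors with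
level-dependent inputs (`L(2,χ₋₃)` for `6θ ∈ ℤ`, Catalan for `4θ ∈ ℤ`, …).
References: M. Kontsevich, D. Zagier, *Periods* (2001), §1.2. No new definitions.
-/

noncomputable section

open MeasureTheory Set
open Literature.NumberTheory.Transcendental Literature.NumberTheory.Transcendental.KZ
open Literature.ModelTheory.ExponentialFields (IsSemialgebraic)

namespace Summit.KontsevichZagierPeriods.HurwitzMicroSectors.NormalFormPrinciple.PiBox.LevelK

open Summit.KontsevichZagierPeriods.HurwitzMicroSectors.NormalFormPrinciple.PiBox.AlgLevelOne
  (alg_exists_reps isAlgebraic_div_nat)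
open Summit.KontsevichZagierPeriods.HurwitzMicroSectors.NormalFormPrinciple.PiBox.AlgLevelTwo
  (levelTwo_exists_reps levelTwoEven_mem_relations_of_eval_eq_zero_of_mem_closure eval_monomial_two)

/-- **Integer resonance joins level one**: if `a + 1 = j k₁` and `b + 1 = j k₂` (`θ₁ = θ₂ = j ∈ ℕ`),
the box `[(0,1)², c x^a y^b/(1 − x^{k₁} y^{k₂})]` is, by the power substitution
`(X,Y) ↦ (X^{k₁}, Y^{k₂})` (rule 2), the algebraic level-one box
`[(0,1)², (c/(k₁k₂)) (uv)^{j−1}/(1 − uv)]`. [cite: KontsevichZagier2001, §1.2 rule (2)] -/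
theorem resonantInt_sub_levelOne (k₁ k₂ : ℕ) (hk₁ : 0 < k₁) (hk₂ : 0 < k₂) (j : ℕ) (hj : 0 < j)
    (a b : ℕ) (ha : a + 1 = j * k₁) (hb : b + 1 = j * k₂) (c : ℝ) (hc : IsAlgebraic ℚ c)
    (N : IntegralRep 2) (hNd : N.domain = {x | ∀ i, x i ∈ Set.Ioo (0:ℝ) 1})
    (hNi : EqOn N.integrand (fun x => c * (x 0 ^ a * x 1 ^ b) / (1 - x 0 ^ k₁ * x 1 ^ k₂)) N.domain) :
    ∃ M : IntegralRep 2, M.domain = {x | ∀ i, x i ∈ Set.Ioo (0:ℝ) 1} ∧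
      (M.integrand = fun x => c / ((k₁ * k₂ : ℕ) : ℝ) * (x 0 ^ (j - 1) * x 1 ^ (j - 1)) / (1 - x 0 * x 1)) ∧
      of N - of M ∈ relations := by
  have hc' : IsAlgebraic ℚ (c / ((k₁ * k₂ : ℕ) : ℝ)) := isAlgebraic_div_nat hc _
  obtain ⟨hexM, -⟩ := alg_exists_reps (c / ((k₁ * k₂ : ℕ) : ℝ)) hc'
  obtain ⟨M, hMd, hMi⟩ := hexM (j - 1) (j - 1)
  refine ⟨M, hMd, hMi, ?_⟩
  have hK : ((k₁ * k₂ : ℕ) : ℝ) ≠ 0 := by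
    have : 0 < k₁ * k₂ := Nat.mul_pos hk₁ hk₂
    positivity
  have hea : (j - 1 + 1) * k₁ - 1 = a := by
    have : (j - 1 + 1) = j := Nat.sub_add_cancel hj
    rw [this]; omega
  have heb : (j - 1 + 1) * k₂ - 1 = b := by
    have : (j - 1 + 1) = j := Nat.sub_add_cancel hj
    rw [this]; omega
  have e := power_substitution k₁ k₂ hk₁ hk₂ 1 1 one_pos one_pos (c / ((k₁ * k₂ : ℕ) : ℝ)) hc'
    (j - 1) (j - 1) M N hMd (fun x _ => by rw [hMi]; simp) hNd (fun x hx => by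
      rw [hNi hx, hea, heb, one_mul, one_mul]
      simp only
      rw [div_mul_cancel₀ _ hK])
  have e' : of N - of M = -(of M - of N) := by abel
  rw [e']
  exact relations.neg_mem e

/-- **Half-integer resonance joins the even level-two layer**: if `a + 1 = (2j+1) k₁'` and
`b + 1 = (2j+1) k₂'` with the levels `k₁ = 2k₁'`, `k₂ = 2k₂'` (`θ₁ = θ₂ = j + ½`), the box
`[(0,1)², c x^a y^b/(1 − x^{2k₁'} y^{2k₂'})]` is, by the power substitution `(X,Y) ↦ (X^{k₁'}, Y^{k₂'})`
(rule 2), the even level-two diagonal box `[(0,1)², (c/(k₁'k₂')) (uv)^{2j}/(1 − u²v²)]`.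
[cite: KontsevichZagier2001, §1.2 rule (2)] -/
theorem resonantHalf_sub_levelTwo (k₁' k₂' : ℕ) (hk₁ : 0 < k₁') (hk₂ : 0 < k₂') (j : ℕ)
    (a b : ℕ) (ha : a + 1 = (2 * j + 1) * k₁') (hb : b + 1 = (2 * j + 1) * k₂') (c : ℝ)
    (hc : IsAlgebraic ℚ c) (N : IntegralRep 2) (hNd : N.domain = {x | ∀ i, x i ∈ Set.Ioo (0:ℝ) 1})
    (hNi : EqOn N.integrand
      (fun x => c * (x 0 ^ a * x 1 ^ b) / (1 - x 0 ^ (2 * k₁') * x 1 ^ (2 * k₂'))) N.domain) :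
    ∃ M : IntegralRep 2, M.domain = {x | ∀ i, x i ∈ Set.Ioo (0:ℝ) 1} ∧
      (M.integrand = fun x => c / ((k₁' * k₂' : ℕ) : ℝ) * (x 0 ^ (2 * j) * x 1 ^ (2 * j)) /
        (1 - x 0 ^ 2 * x 1 ^ 2)) ∧
      of N - of M ∈ relations := by
  have hc' : IsAlgebraic ℚ (c / ((k₁' * k₂' : ℕ) : ℝ)) := isAlgebraic_div_nat hc _
  obtain ⟨hexM, -, -⟩ := levelTwo_exists_reps (c / ((k₁' * k₂' : ℕ) : ℝ)) hc'
  obtain ⟨M, hMd, hMi⟩ := hexM (2 * j) (2 * j)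
  refine ⟨M, hMd, hMi, ?_⟩
  have hK : ((k₁' * k₂' : ℕ) : ℝ) ≠ 0 := by
    have : 0 < k₁' * k₂' := Nat.mul_pos hk₁ hk₂
    positivity
  have hea : (2 * j + 1) * k₁' - 1 = a := by omega
  have heb : (2 * j + 1) * k₂' - 1 = b := by omega
  have e := power_substitution k₁' k₂' hk₁ hk₂ 2 2 two_pos two_pos (c / ((k₁' * k₂' : ℕ) : ℝ)) hc'
    (2 * j) (2 * j) M N hMd (fun x _ => by rw [hMi]) hNd (fun x hx => by
      rw [hNi hx, hea, heb]
      simp only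
      rw [div_mul_cancel₀ _ hK])
  have e' : of N - of M = -(of M - of N) := by abel
  rw [e']
  exact relations.neg_mem e

/-- A monomial level-one box with algebraic coefficient is a generator of the algebraic level-one
layer. [cite: KontsevichZagier2001, §1.2] -/
theorem levelOneMonomial_mem (c : ℝ) (hc : IsAlgebraic ℚ c) (a b : ℕ) (M : IntegralRep 2)
    (hMd : M.domain = {x | ∀ i, x i ∈ Set.Ioo (0:ℝ) 1})
    (hMi : EqOn M.integrand (fun x => c * (x 0 ^ a * x 1 ^ b) / (1 - x 0 * x 1)) M.domain) :
    of M ∈ {y : FormalRep | ∃ (P : MvPolynomial (Fin 2) ℝ) (N : IntegralRep 2),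
      (∀ s, IsAlgebraic ℚ (P.coeff s)) ∧ N.domain = {x | ∀ i, x i ∈ Set.Ioo (0:ℝ) 1} ∧
      EqOn N.integrand (fun x => MvPolynomial.eval x P / (1 - x 0 * x 1)) N.domain ∧ y = of N} := by
  classical
  refine ⟨MvPolynomial.monomial (Finsupp.single 0 a + Finsupp.single 1 b) c, M, fun s => ?_, hMd,
    fun x hx => ?_, rfl⟩
  · rw [MvPolynomial.coeff_monomial]
    split_ifs
    · exact hc
    · exact isAlgebraic_zero
  · rw [hMi hx]
    beta_reduce
    rw [eval_monomial_two]
    simp [Finsupp.add_apply]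

/-- A monomial even level-two box with algebraic coefficient is a generator of the even level-two
layer. [cite: KontsevichZagier2001, §1.2] -/
theorem evenMonomial_mem (c : ℝ) (hc : IsAlgebraic ℚ c) (a b : ℕ) (hev : Even (a + b))
    (M : IntegralRep 2) (hMd : M.domain = {x | ∀ i, x i ∈ Set.Ioo (0:ℝ) 1})
    (hMi : EqOn M.integrand (fun x => c * (x 0 ^ a * x 1 ^ b) / (1 - x 0 ^ 2 * x 1 ^ 2)) M.domain) :
    of M ∈ {y : FormalRep | ∃ (P : MvPolynomial (Fin 2) ℝ) (N : IntegralRep 2),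
      (∀ s, IsAlgebraic ℚ (P.coeff s)) ∧ (∀ s ∈ P.support, Even (s 0 + s 1)) ∧
      N.domain = {x | ∀ i, x i ∈ Set.Ioo (0:ℝ) 1} ∧
      EqOn N.integrand (fun x => MvPolynomial.eval x P / (1 - x 0 ^ 2 * x 1 ^ 2)) N.domain ∧
      y = of N} := by
  classical
  refine ⟨MvPolynomial.monomial (Finsupp.single 0 a + Finsupp.single 1 b) c, M, fun s => ?_,
    fun s hs => ?_, hMd, fun x hx => ?_, rfl⟩
  · rw [MvPolynomial.coeff_monomial]
    split_ifs
    · exact hc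
    · exact isAlgebraic_zero
  · have hs' := MvPolynomial.support_monomial_subset hs
    rw [Finset.mem_singleton] at hs'
    subst hs'
    simpa [Finsupp.add_apply] using hev
  · rw [hMi hx]
    beta_reduce
    rw [eval_monomial_two]
    simp [Finsupp.add_apply]

/-- Every element of the subgroup generated by the even layer's generators TOGETHER WITH the resonant
boxes of all levels with `2θ ∈ ℤ` is congruent modulo relations to an element of the even layer's
subgroup. [cite: KontsevichZagier2001, §1.2] -/
theorem exists_mem_evenClosure_of_mem_resonantClosure {x : FormalRep}
    (hx : x ∈ AddSubgroup.closure
      (({y : FormalRep | ∃ (P : MvPolynomial (Fin 2) ℝ) (N : IntegralRep 2),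
          (∀ s, IsAlgebraic ℚ (P.coeff s)) ∧ (∀ s ∈ P.support, Even (s 0 + s 1)) ∧
          N.domain = {x | ∀ i, x i ∈ Set.Ioo (0:ℝ) 1} ∧
          EqOn N.integrand (fun x => MvPolynomial.eval x P / (1 - x 0 ^ 2 * x 1 ^ 2)) N.domain ∧
          y = of N} ∪
       {y : FormalRep | ∃ (P : MvPolynomial (Fin 2) ℝ) (N : IntegralRep 2),
          (∀ s, IsAlgebraic ℚ (P.coeff s)) ∧ N.domain = {x | ∀ i, x i ∈ Set.Ioo (0:ℝ) 1} ∧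
          EqOn N.integrand (fun x => MvPolynomial.eval x P / (1 - x 0 * x 1)) N.domain ∧ y = of N} ∪
       {y : FormalRep | ∃ (r : ℝ) (Z : IntegralRep 0), IsAlgebraic ℚ r ∧ Z.domain = Set.univ ∧
          (Z.integrand = fun _ => r) ∧ y = of Z}) ∪
       ({y : FormalRep | ∃ (k₁ k₂ j a b : ℕ) (c : ℝ) (N : IntegralRep 2), 0 < k₁ ∧ 0 < k₂ ∧ 0 < j ∧
          a + 1 = j * k₁ ∧ b + 1 = j * k₂ ∧ IsAlgebraic ℚ c ∧
          N.domain = {x | ∀ i, x i ∈ Set.Ioo (0:ℝ) 1} ∧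
          EqOn N.integrand (fun x => c * (x 0 ^ a * x 1 ^ b) / (1 - x 0 ^ k₁ * x 1 ^ k₂)) N.domain ∧
          y = of N} ∪
        {y : FormalRep | ∃ (k₁' k₂' j a b : ℕ) (c : ℝ) (N : IntegralRep 2), 0 < k₁' ∧ 0 < k₂' ∧
          a + 1 = (2 * j + 1) * k₁' ∧ b + 1 = (2 * j + 1) * k₂' ∧ IsAlgebraic ℚ c ∧
          N.domain = {x | ∀ i, x i ∈ Set.Ioo (0:ℝ) 1} ∧
          EqOn N.integrand (fun x => c * (x 0 ^ a * x 1 ^ b) / (1 - x 0 ^ (2 * k₁') * x 1 ^ (2 * k₂')))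
            N.domain ∧ y = of N}))) :
    ∃ x' ∈ AddSubgroup.closure
      ({y : FormalRep | ∃ (P : MvPolynomial (Fin 2) ℝ) (N : IntegralRep 2),
          (∀ s, IsAlgebraic ℚ (P.coeff s)) ∧ (∀ s ∈ P.support, Even (s 0 + s 1)) ∧
          N.domain = {x | ∀ i, x i ∈ Set.Ioo (0:ℝ) 1} ∧
          EqOn N.integrand (fun x => MvPolynomial.eval x P / (1 - x 0 ^ 2 * x 1 ^ 2)) N.domain ∧
          y = of N} ∪
       {y : FormalRep | ∃ (P : MvPolynomial (Fin 2) ℝ) (N : IntegralRep 2),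
          (∀ s, IsAlgebraic ℚ (P.coeff s)) ∧ N.domain = {x | ∀ i, x i ∈ Set.Ioo (0:ℝ) 1} ∧
          EqOn N.integrand (fun x => MvPolynomial.eval x P / (1 - x 0 * x 1)) N.domain ∧ y = of N} ∪
       {y : FormalRep | ∃ (r : ℝ) (Z : IntegralRep 0), IsAlgebraic ℚ r ∧ Z.domain = Set.univ ∧
          (Z.integrand = fun _ => r) ∧ y = of Z}),
      x - x' ∈ relations := by
  induction hx using AddSubgroup.closure_induction with
  | mem y hy =>
    rcases hy with hy | (hy | hy)
    · exact ⟨y, AddSubgroup.subset_closure hy, by simp [relations.zero_mem]⟩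
    · obtain ⟨k₁, k₂, j, a, b, c, N, hk₁, hk₂, hj, ha, hb, hc, hNd, hNi, rfl⟩ := hy
      obtain ⟨M, hMd, hMi, e⟩ := resonantInt_sub_levelOne k₁ k₂ hk₁ hk₂ j hj a b ha hb c hc N hNd hNi
      exact ⟨of M, AddSubgroup.subset_closure (Or.inl (Or.inr (levelOneMonomial_mem _
        (isAlgebraic_div_nat hc _) (j - 1) (j - 1) M hMd (fun x _ => by rw [hMi])))), e⟩
    · obtain ⟨k₁', k₂', j, a, b, c, N, hk₁, hk₂, ha, hb, hc, hNd, hNi, rfl⟩ := hy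
      obtain ⟨M, hMd, hMi, e⟩ := resonantHalf_sub_levelTwo k₁' k₂' hk₁ hk₂ j a b ha hb c hc N hNd hNi
      exact ⟨of M, AddSubgroup.subset_closure (Or.inl (Or.inl (evenMonomial_mem _
        (isAlgebraic_div_nat hc _) (2 * j) (2 * j) ⟨2 * j, rfl⟩ M hMd (fun x _ => by rw [hMi])))), e⟩
  | zero => exact ⟨0, AddSubgroup.zero_mem _, by simp [relations.zero_mem]⟩
  | add y z _ _ ihy ihz =>
    obtain ⟨y', hy', ey⟩ := ihy
    obtain ⟨z', hz', ez⟩ := ihz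
    refine ⟨y' + z', AddSubgroup.add_mem _ hy' hz', ?_⟩
    have e : y + z - (y' + z') = (y - y') + (z - z') := by abel
    rw [e]
    exact relations.add_mem ey ez
  | neg y _ ihy =>
    obtain ⟨y', hy', ey⟩ := ihy
    refine ⟨-y', AddSubgroup.neg_mem _ hy', ?_⟩
    have e : -y - -y' = -(y - y') := by abel
    rw [e]
    exact relations.neg_mem ey

/-- **Conjecture 1 of Kontsevich–Zagier, kernel form, for the π²-LAYER OF WEIGHT TWO INCLUDING ALL
RESONANT BOXES WITH `2θ ∈ ℤ`** — unconditionally: the even level-two boxes, the algebraic level-one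
boxes, the algebraic points AND every box `[(0,1)², c x^a y^b/(1 − x^{k₁}y^{k₂})]` (`c ∈ ℚ̄ ∩ ℝ`) whose
resonance parameter `θ = (a+1)/k₁ = (b+1)/k₂` is an integer or a half-integer generate a subgroup on
which value `0` forces a relation (one power substitution, rule 2, then the even layer and Lindemann).
[cite: KontsevichZagier2001, §1.2 Conjecture 1] -/
theorem resonant_mem_relations_of_eval_eq_zero_of_mem_closure {x : FormalRep}
    (hx : x ∈ AddSubgroup.closure
      (({y : FormalRep | ∃ (P : MvPolynomial (Fin 2) ℝ) (N : IntegralRep 2),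
          (∀ s, IsAlgebraic ℚ (P.coeff s)) ∧ (∀ s ∈ P.support, Even (s 0 + s 1)) ∧
          N.domain = {x | ∀ i, x i ∈ Set.Ioo (0:ℝ) 1} ∧
          EqOn N.integrand (fun x => MvPolynomial.eval x P / (1 - x 0 ^ 2 * x 1 ^ 2)) N.domain ∧
          y = of N} ∪
       {y : FormalRep | ∃ (P : MvPolynomial (Fin 2) ℝ) (N : IntegralRep 2),
          (∀ s, IsAlgebraic ℚ (P.coeff s)) ∧ N.domain = {x | ∀ i, x i ∈ Set.Ioo (0:ℝ) 1} ∧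
          EqOn N.integrand (fun x => MvPolynomial.eval x P / (1 - x 0 * x 1)) N.domain ∧ y = of N} ∪
       {y : FormalRep | ∃ (r : ℝ) (Z : IntegralRep 0), IsAlgebraic ℚ r ∧ Z.domain = Set.univ ∧
          (Z.integrand = fun _ => r) ∧ y = of Z}) ∪
       ({y : FormalRep | ∃ (k₁ k₂ j a b : ℕ) (c : ℝ) (N : IntegralRep 2), 0 < k₁ ∧ 0 < k₂ ∧ 0 < j ∧
          a + 1 = j * k₁ ∧ b + 1 = j * k₂ ∧ IsAlgebraic ℚ c ∧
          N.domain = {x | ∀ i, x i ∈ Set.Ioo (0:ℝ) 1} ∧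
          EqOn N.integrand (fun x => c * (x 0 ^ a * x 1 ^ b) / (1 - x 0 ^ k₁ * x 1 ^ k₂)) N.domain ∧
          y = of N} ∪
        {y : FormalRep | ∃ (k₁' k₂' j a b : ℕ) (c : ℝ) (N : IntegralRep 2), 0 < k₁' ∧ 0 < k₂' ∧
          a + 1 = (2 * j + 1) * k₁' ∧ b + 1 = (2 * j + 1) * k₂' ∧ IsAlgebraic ℚ c ∧
          N.domain = {x | ∀ i, x i ∈ Set.Ioo (0:ℝ) 1} ∧
          EqOn N.integrand (fun x => c * (x 0 ^ a * x 1 ^ b) / (1 - x 0 ^ (2 * k₁') * x 1 ^ (2 * k₂')))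
            N.domain ∧ y = of N})))
    (hv : eval x = 0) : x ∈ relations := by
  obtain ⟨x', hx', e⟩ := exists_mem_evenClosure_of_mem_resonantClosure hx
  have h0 : eval x' = 0 := by
    have h := relations_le_ker_eval_holds e
    rw [AddMonoidHom.mem_ker, map_sub, hv, zero_sub, neg_eq_zero] at h
    exact h
  have hx'r := levelTwoEven_mem_relations_of_eval_eq_zero_of_mem_closure hx' h0
  have e' : x = (x - x') + x' := by abel
  rw [e']
  exact relations.add_mem e hx'r

/-- **Example: `∫∫_{(0,1)²} y dxdy/(1 − x²y⁴)` (`θ = ½`, value `π²/16`) against the ζ-box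
`[(0,1)², c'/(1−xy)]`** — equal values imply KZ-equivalence, unconditionally.
[cite: KontsevichZagier2001, §1.2 Conjecture 1] -/
theorem resonantHalf_example_equivalent_zetaBox_of_value_eq (c c' : ℝ) (hc : IsAlgebraic ℚ c)
    (hc' : IsAlgebraic ℚ c') (N N' : IntegralRep 2) (hNd : N.domain = {x | ∀ i, x i ∈ Set.Ioo (0:ℝ) 1})
    (hNi : EqOn N.integrand (fun x => c * x 1 / (1 - x 0 ^ 2 * x 1 ^ 4)) N.domain)
    (hN'd : N'.domain = {x | ∀ i, x i ∈ Set.Ioo (0:ℝ) 1})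
    (hN'i : EqOn N'.integrand (fun x => c' / (1 - x 0 * x 1)) N'.domain)
    (hv : N.value = N'.value) : Equivalent N N' := by
  have hN : of N ∈ {y : FormalRep | ∃ (k₁' k₂' j a b : ℕ) (c : ℝ) (N : IntegralRep 2), 0 < k₁' ∧ 0 < k₂' ∧
      a + 1 = (2 * j + 1) * k₁' ∧ b + 1 = (2 * j + 1) * k₂' ∧ IsAlgebraic ℚ c ∧
      N.domain = {x | ∀ i, x i ∈ Set.Ioo (0:ℝ) 1} ∧
      EqOn N.integrand (fun x => c * (x 0 ^ a * x 1 ^ b) / (1 - x 0 ^ (2 * k₁') * x 1 ^ (2 * k₂')))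
        N.domain ∧ y = of N} :=
    ⟨1, 2, 0, 0, 1, c, N, one_pos, two_pos, by norm_num, by norm_num, hc, hNd,
      fun x hx => by rw [hNi hx]; norm_num, rfl⟩
  have hN' := levelOneMonomial_mem c' hc' 0 0 N' hN'd (fun x hx => by rw [hN'i hx]; simp)
  refine resonant_mem_relations_of_eval_eq_zero_of_mem_closure (AddSubgroup.sub_mem _
    (AddSubgroup.subset_closure (Or.inr (Or.inr hN)))
    (AddSubgroup.subset_closure (Or.inl (Or.inl (Or.inr hN'))))) ?_
  rw [map_sub, eval_of, eval_of, hv, sub_self]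


end Summit.KontsevichZagierPeriods.HurwitzMicroSectors.NormalFormPrinciple.PiBox.LevelK
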